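import Mathlib.Tactic
import Literature.NumberTheory.EllipticCurves.Rank1Residual.Typed.Basic
import HarnessLib

set_option linter.dupNamespace false
set_option autoImplicit false

/-!
# Stub-ideation k = 1 (gen 13) for `stub_heegnerIndexLowerAtTwo` — technique «weaken / strengthen»:
# THE ANCHOR OF ARM M″ IS CONSUMED ONLY THROUGH ITS LOWER HALF (`A₀ ≤ B₀`), and on road T1⁻ the defect
# `A − B` is an exact key-translate (so LOWER- and UPPER-anchors may be DIFFERENT members of a key).

Sketch for the crux item `stmt-BirchSwinnertonDyer-27851` (`PrintCf2.SplitBadTwoLowerHalfOfFacts`, LOWER child),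
card `Ideas/stub-heegnerindexloweratwo-k1-g13.md`. Theorems only; no `sorry`; no definition; no instance;
nothing here proves the stub, the crux, or BSD — BSD is NOT proved by any of this.

CURRENCY = the critic's certificate `StubPlanT3ArmMPrimeS3cExact.lean` (arm M″, STUB-PLAN v3.x T3.6-M″), binder for binder:
`A := v₂ Ш_an(W)` (`padicValRat 2 q`, `shaAn W = q`), `B := v₂ #Ш(W/ℚ)[2^∞]`, `m` = the S2′ (Rubin/BDP value) side,
`n` = the S3c (restricted control, THEOREM `restrictedControl_two_holds`) side, `g` = the common bracket
`v₂ Tam − 2 v₂ #tors + 2ℓ`, `eA / eM / eC` = the keyed corrections of S2′ / T1 / S3c, subscript `₀` = the anchor `W₀`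
of the same 2-adic key. Hypotheses named as in `armMsecond_member_exact`:
`hS2 : m = 2(A+g)+eA` (S2′ at the member), `hMC : m ≤ 2n+eM` (T1 containment at the member), `hS3c : n = B+g+eC`,
`hS2₀`, `hES₀ : 2n₀+eM₀ ≤ m₀` (ES-direction at the anchor = `ε₀ = 0`, Müller 2020 Thm 3.21, §3 (vii)(c)), `hS3c₀`,
floors `hflA : eA₀ ≤ eA` (F-A), `hceM : eM ≤ eM₀` (C-M).

§A  the weakest sufficient anchor (ℤ-shadow, `omega`): `hBSD₀ : A₀ = B₀` ↦ `hLow₀ : A₀ ≤ B₀`; master budget form; sharpness.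
§B  road T1⁻ (cofactor identity `2n = 2(A+g) − e + ρ + 2σ + 2ε`): the defect is an EXACT key-translate
    `A − B = (A₀ − B₀) − (σ − σ₀)`; LOWER from a LOWER-anchor, UPPER from an UPPER-anchor, BSD₂ from two half-anchors.
§C  real currency: `MissingLowerBoundAt W p` from `v_p Ш_an ≤ 0` (odd `Ш_an` at `p = 2`) or from an EXHIBITED `p^k ∣ #Ш`
    — the two Kolyvagin-free ways an anchor's LOWER half is booked (R92″ of the card).
§D  bookkeeping shadow of the card's fallback PLAN C (congruence transfer of the T1⁻ digit `σ` along a key).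
-/

namespace Summit.BirchSwinnertonDyer.BirchSwinnertonDyer.Cruxes.SplitBadTwoLowerHalfOfFacts.StubIdeasK1G13

/-! ## §A  Arm M″: the anchor is consumed only through `A₀ ≤ B₀` -/

/-- DEFECT TRANSPORT WITH SLACK (no anchor hypothesis at all, no floors): the member's defect `A − B` plus the two
floor slacks is bounded by TWICE the anchor's defect. Everything the anchor contributes to LOWER enters through
`A₀ − B₀`. -/
theorem defect_transport_with_slack {A B m n g eA eM eC A₀ B₀ m₀ n₀ g₀ eA₀ eM₀ : ℤ}
    (hS2 : m = 2 * (A + g) + eA) (hMC : m ≤ 2 * n + eM) (hS3c : n = B + g + eC)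
    (hS2₀ : m₀ = 2 * (A₀ + g₀) + eA₀) (hES₀ : 2 * n₀ + eM₀ ≤ m₀) (hS3c₀ : n₀ = B₀ + g₀ + eC) :
    2 * (A - B) + (eA - eA₀) + (eM₀ - eM) ≤ 2 * (A₀ - B₀) := by
  omega

/-- With the two floors (F-A), (C-M): the member's defect is at most the anchor's defect — «LOWER is contagious
along a key». -/
theorem defect_le_anchorDefect {A B m n g eA eM eC A₀ B₀ m₀ n₀ g₀ eA₀ eM₀ : ℤ}
    (hS2 : m = 2 * (A + g) + eA) (hMC : m ≤ 2 * n + eM) (hS3c : n = B + g + eC)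
    (hS2₀ : m₀ = 2 * (A₀ + g₀) + eA₀) (hES₀ : 2 * n₀ + eM₀ ≤ m₀) (hS3c₀ : n₀ = B₀ + g₀ + eC)
    (hflA : eA₀ ≤ eA) (hceM : eM ≤ eM₀) : A - B ≤ A₀ - B₀ := by
  omega

/-- **THE WEAKEST SUFFICIENT ANCHOR.** `armMsecond_member_exact` with `hBSD₀ : A₀ = B₀` replaced by the anchor's
LOWER HALF `hLow₀ : A₀ ≤ B₀` (= `MissingLowerBoundAt W₀ 2` in real currency): still `A ≤ B` exactly, no `+1`. -/
theorem lower_of_lowerAnchor {A B m n g eA eM eC A₀ B₀ m₀ n₀ g₀ eA₀ eM₀ : ℤ}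
    (hS2 : m = 2 * (A + g) + eA) (hMC : m ≤ 2 * n + eM) (hS3c : n = B + g + eC)
    (hS2₀ : m₀ = 2 * (A₀ + g₀) + eA₀) (hES₀ : 2 * n₀ + eM₀ ≤ m₀) (hS3c₀ : n₀ = B₀ + g₀ + eC)
    (hflA : eA₀ ≤ eA) (hceM : eM ≤ eM₀) (hLow₀ : A₀ ≤ B₀) : A ≤ B := by
  omega

/-- The critic's `armMsecond_member_exact` (anchor `A₀ = B₀`) is the special case `hLow₀ := hBSD₀.le`. -/
theorem armMsecond_member_exact' {A B m n g eA eM eC A₀ B₀ m₀ n₀ g₀ eA₀ eM₀ : ℤ}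
    (hS2 : m = 2 * (A + g) + eA) (hMC : m ≤ 2 * n + eM) (hS3c : n = B + g + eC)
    (hS2₀ : m₀ = 2 * (A₀ + g₀) + eA₀) (hES₀ : 2 * n₀ + eM₀ ≤ m₀) (hS3c₀ : n₀ = B₀ + g₀ + eC)
    (hBSD₀ : A₀ = B₀) (hflA : eA₀ ≤ eA) (hceM : eM ≤ eM₀) : A ≤ B :=
  lower_of_lowerAnchor hS2 hMC hS3c hS2₀ hES₀ hS3c₀ hflA hceM hBSD₀.le

/-- ODD-`Ш_an` ANCHOR: if the anchor's analytic Sha order is a 2-adic unit (`A₀ = 0`; Gross–Zagier + Heegner-index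
oddness, no descent, no Euler system) then, `B₀ ≥ 0` being automatic, LOWER holds on the whole key. -/
theorem lower_of_oddShaAnAnchor {A B m n g eA eM eC A₀ B₀ m₀ n₀ g₀ eA₀ eM₀ : ℤ}
    (hS2 : m = 2 * (A + g) + eA) (hMC : m ≤ 2 * n + eM) (hS3c : n = B + g + eC)
    (hS2₀ : m₀ = 2 * (A₀ + g₀) + eA₀) (hES₀ : 2 * n₀ + eM₀ ≤ m₀) (hS3c₀ : n₀ = B₀ + g₀ + eC)
    (hflA : eA₀ ≤ eA) (hceM : eM ≤ eM₀) (hA₀ : A₀ = 0) (hB₀ : 0 ≤ B₀) : A ≤ B := by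
  omega

/-- EXHIBITED-`Ш` ANCHOR: `A₀ ≤ X₀ ≤ B₀`, where `2^{X₀} ∣ #Ш(W₀)[2^∞]` is EXHIBITED (explicit elements / a
`2^k`-descent lower bound — again no Euler system), suffices. -/
theorem lower_of_exhibitedSha {A B m n g eA eM eC A₀ B₀ m₀ n₀ g₀ eA₀ eM₀ X₀ : ℤ}
    (hS2 : m = 2 * (A + g) + eA) (hMC : m ≤ 2 * n + eM) (hS3c : n = B + g + eC)
    (hS2₀ : m₀ = 2 * (A₀ + g₀) + eA₀) (hES₀ : 2 * n₀ + eM₀ ≤ m₀) (hS3c₀ : n₀ = B₀ + g₀ + eC)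
    (hflA : eA₀ ≤ eA) (hceM : eM ≤ eM₀) (hX : A₀ ≤ X₀) (hXB : X₀ ≤ B₀) : A ≤ B := by
  omega

/-- **MASTER (WEAKEST) FORM — the total signed budget.** No floors and no anchor identity as separate hypotheses:
LOWER at the member follows as soon as the floor slacks, twice the cross-key table difference and twice the anchor's
defect sum to at most `1` (the parity of `2(A − B)` absorbs one unit). Same-key use: `eC = eC₀`. -/
theorem lower_of_totalBudget {A B m n g eA eM eC A₀ B₀ m₀ n₀ g₀ eA₀ eM₀ eC₀ : ℤ}
    (hS2 : m = 2 * (A + g) + eA) (hMC : m ≤ 2 * n + eM) (hS3c : n = B + g + eC)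
    (hS2₀ : m₀ = 2 * (A₀ + g₀) + eA₀) (hES₀ : 2 * n₀ + eM₀ ≤ m₀) (hS3c₀ : n₀ = B₀ + g₀ + eC₀)
    (hbudget : (eA₀ - eA) + (eM - eM₀) + 2 * (eC - eC₀) + 2 * (A₀ - B₀) ≤ 1) : A ≤ B := by
  omega

/-- Slack form of the floors: an (F-A)-defect `dA` and a (C-M)-defect `dM` are absorbed as long as
`dA + dM ≤ 2(B₀ − A₀) + 1` — so a STRICT LOWER-anchor (`A₀ < B₀`) buys floor slack, and at a BSD₂-anchor exactly one
unit of slack is free. -/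
theorem lower_of_slack {A B m n g eA eM eC A₀ B₀ m₀ n₀ g₀ eA₀ eM₀ dA dM : ℤ}
    (hS2 : m = 2 * (A + g) + eA) (hMC : m ≤ 2 * n + eM) (hS3c : n = B + g + eC)
    (hS2₀ : m₀ = 2 * (A₀ + g₀) + eA₀) (hES₀ : 2 * n₀ + eM₀ ≤ m₀) (hS3c₀ : n₀ = B₀ + g₀ + eC)
    (hflA' : eA₀ ≤ eA + dA) (hceM' : eM ≤ eM₀ + dM) (hd : dA + dM ≤ 2 * (B₀ - A₀) + 1) : A ≤ B := by
  omega

/-- ONE-SIDED CROSS-KEY TRANSPORT: from a LOWER-anchor on ANOTHER key `k₀` (table value `eC₀`) LOWER on key `k`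
needs only the SIGN `eC ≤ eC₀` of the table difference (plus the cross-pair floors) — not the table's values
(cf. the critic's `armMsecond_crossKey` / `crossKey_sharp`; R96 decides the sign). -/
theorem lower_crossKey_of_tableLe {A B m n g eA eM eC A₀ B₀ m₀ n₀ g₀ eA₀ eM₀ eC₀ : ℤ}
    (hS2 : m = 2 * (A + g) + eA) (hMC : m ≤ 2 * n + eM) (hS3c : n = B + g + eC)
    (hS2₀ : m₀ = 2 * (A₀ + g₀) + eA₀) (hES₀ : 2 * n₀ + eM₀ ≤ m₀) (hS3c₀ : n₀ = B₀ + g₀ + eC₀)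
    (hflA : eA₀ ≤ eA) (hceM : eM ≤ eM₀) (hLow₀ : A₀ ≤ B₀) (htab : eC ≤ eC₀) : A ≤ B := by
  omega

/-! ### Sharpness of §A (explicit integer witnesses) -/

/-- Without ANY anchor inequality the machine calibrates nothing: all member/anchor laws and both floors hold with
`A₀ = B₀ + 100` and `A = B + 100`. -/
theorem noAnchorInequality_calibrates_nothing :
    ∃ A B m n g eA eM eC A₀ B₀ m₀ n₀ g₀ eA₀ eM₀ : ℤ,
      m = 2 * (A + g) + eA ∧ m ≤ 2 * n + eM ∧ n = B + g + eC ∧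
      m₀ = 2 * (A₀ + g₀) + eA₀ ∧ 2 * n₀ + eM₀ ≤ m₀ ∧ n₀ = B₀ + g₀ + eC ∧
      eA₀ ≤ eA ∧ eM ≤ eM₀ ∧ A₀ = B₀ + 100 ∧ A = B + 100 :=
  ⟨100, 0, 200, 100, 0, 0, 0, 100, 100, 0, 200, 100, 0, 0, 0, by omega⟩

/-- A LOWER-anchor gives NO upper bound at members (the UPPER half does not transport through containment):
all laws, floors and `A₀ ≤ B₀` hold with `B = A + 100`. -/
theorem lowerAnchor_gives_no_upper :
    ∃ A B m n g eA eM eC A₀ B₀ m₀ n₀ g₀ eA₀ eM₀ : ℤ,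
      m = 2 * (A + g) + eA ∧ m ≤ 2 * n + eM ∧ n = B + g + eC ∧
      m₀ = 2 * (A₀ + g₀) + eA₀ ∧ 2 * n₀ + eM₀ ≤ m₀ ∧ n₀ = B₀ + g₀ + eC ∧
      eA₀ ≤ eA ∧ eM ≤ eM₀ ∧ A₀ ≤ B₀ ∧ B = A + 100 :=
  ⟨0, 100, 0, 100, 0, 0, 0, 0, 0, 0, 0, 0, 0, 0, 0, by omega⟩

/-- The budget `1` of `lower_of_totalBudget` / `lower_of_slack` is sharp: floor slack `2` at a BSD₂-anchor already
allows `A = B + 1`. -/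
theorem slack_two_fails :
    ∃ A B m n g eA eM eC A₀ B₀ m₀ n₀ g₀ eA₀ eM₀ : ℤ,
      m = 2 * (A + g) + eA ∧ m ≤ 2 * n + eM ∧ n = B + g + eC ∧
      m₀ = 2 * (A₀ + g₀) + eA₀ ∧ 2 * n₀ + eM₀ ≤ m₀ ∧ n₀ = B₀ + g₀ + eC ∧
      eA₀ ≤ eA + 2 ∧ eM ≤ eM₀ ∧ A₀ = B₀ ∧ A = B + 1 :=
  ⟨1, 0, 0, 0, 0, -2, 0, 0, 0, 0, 0, 0, 0, 0, 0, by omega⟩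

/-! ## §B  Road T1⁻: the defect is an exact key-translate — half-anchors at different members -/

/-- On road T1⁻ (cofactor identity `2n = 2(A+g) − e + ρ + 2σ + 2ε`, `ε = 0` by Müller at member AND anchor,
`e`, `ρ` key/global constants) the defect is an EXACT translate of the anchor's:
`A − B = (A₀ − B₀) − (σ − σ₀)`. -/
theorem defect_T1minus_exact {A B n g e ρ σ ε eC A₀ B₀ n₀ g₀ σ₀ ε₀ : ℤ}
    (hW : 2 * n = 2 * (A + g) - e + ρ + 2 * σ + 2 * ε) (hε : ε = 0) (hS3c : n = B + g + eC)
    (h0 : 2 * n₀ = 2 * (A₀ + g₀) - e + ρ + 2 * σ₀ + 2 * ε₀) (hε₀ : ε₀ = 0) (hS3c₀ : n₀ = B₀ + g₀ + eC) :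
    A - B = (A₀ - B₀) - (σ - σ₀) := by
  omega

/-- LOWER on road T1⁻ from a LOWER-anchor and σ-monotonicity `σ₀ ≤ σ` (R91 / k3-g13's `σ ≡ 0`): the critic's
`armMsecond_T1minus` with `hBSD₀` weakened to `hLow₀`. -/
theorem lower_of_T1minus_lowerAnchor {A B n g e ρ σ ε eC A₀ B₀ n₀ g₀ σ₀ ε₀ : ℤ}
    (hW : 2 * n = 2 * (A + g) - e + ρ + 2 * σ + 2 * ε) (hε : ε = 0) (hS3c : n = B + g + eC)
    (h0 : 2 * n₀ = 2 * (A₀ + g₀) - e + ρ + 2 * σ₀ + 2 * ε₀) (hε₀ : ε₀ = 0) (hS3c₀ : n₀ = B₀ + g₀ + eC)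
    (hLow₀ : A₀ ≤ B₀) (hσ : σ₀ ≤ σ) : A ≤ B := by
  omega

/-- The STRONGEST PROVABLE FORM on road T1⁻: UPPER also transports, from an UPPER-anchor `B₁ ≤ A₁` (e.g. a member
with `Ш(W₁)[2] = 0` by 2-descent and `v₂ Ш_an(W₁) ≥ 0`) and `σ ≤ σ₁`. -/
theorem upper_of_T1minus_upperAnchor {A B n g e ρ σ ε eC A₁ B₁ n₁ g₁ σ₁ ε₁ : ℤ}
    (hW : 2 * n = 2 * (A + g) - e + ρ + 2 * σ + 2 * ε) (hε : ε = 0) (hS3c : n = B + g + eC)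
    (h1 : 2 * n₁ = 2 * (A₁ + g₁) - e + ρ + 2 * σ₁ + 2 * ε₁) (hε₁ : ε₁ = 0) (hS3c₁ : n₁ = B₁ + g₁ + eC)
    (hUp₁ : B₁ ≤ A₁) (hσ : σ ≤ σ₁) : B ≤ A := by
  omega

/-- TWO HALF-ANCHORS: with `σ` key-constant (k3-g13), a LOWER-anchor `W₀` and an UPPER-anchor `W₁` — possibly
DIFFERENT members of the key, neither of which needs BSD₂ — give `A = B` (BSD₂) at every member. This is what
the parent 20368 consumes; the LOWER child consumes `W₀` alone. -/
theorem bsd_of_twoHalfAnchors_T1minus {A B n g e ρ σ ε eC A₀ B₀ n₀ g₀ σ₀ ε₀ A₁ B₁ n₁ g₁ σ₁ ε₁ : ℤ}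
    (hW : 2 * n = 2 * (A + g) - e + ρ + 2 * σ + 2 * ε) (hε : ε = 0) (hS3c : n = B + g + eC)
    (h0 : 2 * n₀ = 2 * (A₀ + g₀) - e + ρ + 2 * σ₀ + 2 * ε₀) (hε₀ : ε₀ = 0) (hS3c₀ : n₀ = B₀ + g₀ + eC)
    (h1 : 2 * n₁ = 2 * (A₁ + g₁) - e + ρ + 2 * σ₁ + 2 * ε₁) (hε₁ : ε₁ = 0) (hS3c₁ : n₁ = B₁ + g₁ + eC)
    (hLow₀ : A₀ ≤ B₀) (hUp₁ : B₁ ≤ A₁) (hσ₀ : σ₀ = σ) (hσ₁ : σ₁ = σ) : A = B := by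
  omega

/-- Sharpness of §B: on road T1⁻ a LOWER-anchor alone still gives no UPPER bound (`B = A + 100` consistent). -/
theorem T1minus_lowerAnchor_gives_no_upper :
    ∃ A B n g e ρ σ ε eC A₀ B₀ n₀ g₀ σ₀ ε₀ : ℤ,
      2 * n = 2 * (A + g) - e + ρ + 2 * σ + 2 * ε ∧ ε = 0 ∧ n = B + g + eC ∧
      2 * n₀ = 2 * (A₀ + g₀) - e + ρ + 2 * σ₀ + 2 * ε₀ ∧ ε₀ = 0 ∧ n₀ = B₀ + g₀ + eC ∧
      A₀ ≤ B₀ ∧ σ₀ ≤ σ ∧ B = A + 100 :=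
  ⟨0, 100, 100, 0, 0, 0, 100, 0, 0, 0, 0, 0, 0, 0, 0, by omega⟩

/-! ## §C  Real currency: the two Kolyvagin-free bookings of an anchor's LOWER half -/

open Literature.NumberTheory.EllipticCurves Literature.NumberTheory.EllipticCurves.Rank1Residual.Typed

/-- R92″(i): an anchor whose analytic Sha order has `v_p ≤ 0` (at `p = 2`: `Ш_an(W₀)` ODD — Gross–Zagier plus the
oddness of the Heegner index, no descent on `W₀`, no Euler system) satisfies `MissingLowerBoundAt W₀ p`, because
`v_p #Ш ≥ 0` always (junk value `0` of `Nat.card` included). -/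
theorem missingLowerBoundAt_of_padicValRat_le_zero (W : WeierstrassCurve ℚ) (p : ℕ)
    (h : ∃ q : ℚ, shaAn W = (q : ℂ) ∧ padicValRat p q ≤ 0) : MissingLowerBoundAt W p := by
  obtain ⟨q, hq, hv⟩ := h
  exact ⟨q, hq, hv.trans (by exact_mod_cast Nat.zero_le _)⟩

/-- R92″(ii): an anchor with `v_p Ш_an(W₀) ≤ k` and an EXHIBITED `p^k ∣ #Ш(W₀)` (`Ш(W₀)` finite, so `#Ш ≠ 0`)
satisfies `MissingLowerBoundAt W₀ p` — the upper bound on `#Ш` (Kolyvagin) is never consumed. -/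
theorem missingLowerBoundAt_of_pow_dvd_shaOrder (W : WeierstrassCurve ℚ) (p k : ℕ) [hp : Fact p.Prime]
    (h : ∃ q : ℚ, shaAn W = (q : ℂ) ∧ padicValRat p q ≤ k) (hne : W.shaOrder ≠ 0) (hk : p ^ k ∣ W.shaOrder) :
    MissingLowerBoundAt W p := by
  obtain ⟨q, hq, hv⟩ := h
  refine ⟨q, hq, hv.trans ?_⟩
  exact_mod_cast (padicValNat_dvd_iff_le hne).mp hk

/-- Conversely nothing is lost: `MissingPPartAt` (both halves, e.g. Miller's `BSD(W₀, p)`) gives the LOWER half. -/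
theorem missingLowerBoundAt_of_missingPPartAt (W : WeierstrassCurve ℚ) (p : ℕ) (h : MissingPPartAt W p) :
    MissingLowerBoundAt W p := by
  obtain ⟨q, hq, hv⟩ := h
  exact ⟨q, hq, hv.le⟩

/-! ## §D  PLAN C shadow: congruence transfer of the T1⁻ digit along a key -/

/-- If the algebraic λ-invariants of two congruent members differ by the same amount `Δ` as the analytic ones
(Greenberg–Vatsal / Emerton–Pollack–Weston shape, imprimitive on both sides), and the d-independent factors
`r′` agree, then the cofactor digits agree: `λ(s_W) = λ(s_{W′})` — the bookkeeping behind «σ is a key constant». -/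
theorem sigma_transfer {lf lG lr ls lf₀ lG₀ ls₀ Δ : ℤ}
    (hW : lf = lG + lr + ls) (h0 : lf₀ = lG₀ + lr + ls₀) (halg : lf - lf₀ = Δ) (han : lG - lG₀ = Δ) :
    ls = ls₀ := by
  omega

end Summit.BirchSwinnertonDyer.BirchSwinnertonDyer.Cruxes.SplitBadTwoLowerHalfOfFacts.StubIdeasK1G13
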